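import Literature.AlgebraicGeometry.Resolution.ArithmeticalThreefoldsDescentHeadRankOne
import HarnessLib

/-!
# Cossart–Piltant 2019, Prop. 4.8: the rank-one head with the formal branch and the extension
# CHOSEN, per ground field

Topic: `Literature/AlgebraicGeometry/Resolution` (proofs only; no new notions, no new named
facts). Continuation of `ArithmeticalThreefoldsDescentHeadRankOne.lean`. Two further faithfulness
repairs of the typed geometric head of Cossart–Piltant's descent (journal Prop. 4.8 = arXiv v1
Prop. 4.6, *Resolution of singularities of arithmetical threefolds*, J. Algebra 529 (2019) =
arXiv:1412.0868, pp. 52–53), on top of the rank-one cut: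

1. **The prover of the head CHOOSES the formal branch and the extension.** In print: "Let `v̂` be
   an extension of `v` to, say `K̂₁`, after possibly renumbering" — ONE minimal prime `P̂₁` of `Â`
   and ONE extension `v̂` are chosen, whereas the binder `head` of
   `CossartPiltant2019LU3OfComplete.of_head` demands the construction for EVERY `K̂₁`, `ι`, `O'`.
   The consumer (`exists_adjoin_isRegularLocalRing_of_headData`) only needs SOME such data, so the
   head is restated in `∃`-form (`exists_adjoin_isRegularLocalRing_of_headChoiceAt`, pointwise).
2. **Per ground field.** Novacoski–Spivakovsky's induction and the closed-points reduction never
   leave the ground field `k` (`localUniformization3_of_closedPoints_rankOne_over`: (LU) along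
   rank-one valuations for the `B_𝔭` with `B` of finite type over THIS `k`), so the head can be
   asked field by field (`localUniformization3_of_headChoiceRankOne`) — which is what a
   characteristic-`p` consumer needs (the completions `Â` of local rings of `k`-varieties have
   residue characteristic `p`, where Cossart–Piltant's reduction `CossartPiltant2019ReductionP`
   applies and Hironaka's theorem is idle).

* `localUniformization3_of_closedPoints_rankOne_over` — `LocalUniformization3 k` from surface
  resolution over all fields and (LU) ALONG RANK-ONE VALUATIONS for the local rings `B_𝔭`
  (`B` a three-dimensional domain of finite type over `k`, `𝔭` maximal, `dim B_𝔭 = 3`);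
* `exists_adjoin_isRegularLocalRing_of_headChoiceAt` — (LU) at one valuation ring `O` from the
  head's output for SOME formal branch `K̂₁`, embedding `ι` and extension `O'` with `O' ∩ K = O`;
* `localUniformization3_of_headChoiceRankOne` — `LocalUniformization3 k` from surface resolution
  and the `∃`-form head along rank-one valuations for the `B_𝔭` over `k`;
* `CossartPiltant2019LU3OfComplete.of_headChoiceRankOne` — the descent leaf from surface
  resolution and the `∃`-form rank-one head (allowed to use `CossartPiltant2019LUComplete3`).

Universe `0` for the assemblies (the Novacoski–Spivakovsky files are written at `Type`).

## Sources

* V. Cossart, O. Piltant, J. Algebra 529 (2019) 268–535 = arXiv:1412.0868, §4.1 (LU) and proof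
  of Prop. 4.8 with Lemma 4.7 (arXiv v1: Prop. 4.6, pp. 52–53). [CossartPiltant2019]
* J. Novacoski, M. Spivakovsky (2014), Thm. 1.1. [NovacoskiSpivakovsky2014]
-/

noncomputable section

open IsLocalRing Polynomial

open scoped IntermediateField

namespace Literature.AlgebraicGeometry.Resolution

universe u

/-! ## Closed points at rank one, over a fixed ground field -/

/-- **`LocalUniformization3 k` from surface resolution and (LU) along rank-one valuations at the
closed three-dimensional centres of `k`-models** — `localUniformization3_of_closedPoints_rankOne`
with its second hypothesis asked only for domains `B` of finite type over THE GIVEN field `k`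
(Novacoski–Spivakovsky's induction in transcendence degree `≤ 3` and the closed-points case
analysis stay over `k`). Proof: that of `localUniformization3_of_closedPoints_rankOne` verbatim.
[cite: CossartPiltant2019, §4.1 (LU) and proof of Prop. 4.8 (arXiv v1: Prop. 4.6, pp. 52–53)]
[cite: NovacoskiSpivakovsky2014, Thm. 1.1] -/
theorem localUniformization3_of_closedPoints_rankOne_over (hCJS : CossartJannsenSaito2020.{0})
    (k : Type) [Field k]
    (h3 : ∀ (B : Type) [CommRing B] [IsDomain B] [Algebra k B]
      [Algebra.FiniteType k B] (p : Ideal B) [p.IsMaximal],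
      ringKrullDim B = 3 → ringKrullDim (Localization.AtPrime p) = 3 →
      ∀ (K : Type) [Field K] [Algebra (Localization.AtPrime p) K]
        [IsFractionRing (Localization.AtPrime p) K] (O : ValuationSubring K),
      Nonempty O.valuation.RankOne →
      (∀ a : Localization.AtPrime p, algebraMap _ K a ∈ O) →
      (∀ a ∈ maximalIdeal (Localization.AtPrime p), O.valuation (algebraMap _ K a) < 1) →
      (∀ x : O, ∃ q : (Localization.AtPrime p)[X],
        (∃ i, q.coeff i ∉ maximalIdeal (Localization.AtPrime p)) ∧
          O.valuation (q.eval₂ (algebraMap _ K) x) < 1) →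
      ∃ (s : Finset K) (h : (Algebra.adjoin (Localization.AtPrime p) (s : Set K)).toSubring ≤
          O.toSubring),
        IsRegularLocalRing (Localization.AtPrime
          (Ideal.comap (Subring.inclusion h) (maximalIdeal O)))) :
    LocalUniformization3 k := by
  classical
  -- the rank-one case: the case analysis of `localUniformization3_of_closedPoints`
  have hrank1 : ∀ (K : Type) [Field K] [Algebra k K], Algebra.trdeg k K ≤ (3 : ℕ) →
      ∀ O : ValuationSubring K, Nonempty O.valuation.RankOne → RelLocalUniformization k K O := by
    intro K _ _ hK O hrk A hfg hfr hAO
    haveI := hfr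
    haveI : Algebra.FiniteType k A := A.fg_iff_finiteType.mp hfg
    have hdim : ringKrullDim A ≤ 3 := ringKrullDim_le_of_fg_of_trdeg_le A hfg hK
    obtain ⟨n, hn, -⟩ := exists_ringKrullDim_eq_and_trdeg_eq k A
    have hn3 : n ≤ 3 := by
      have h1 : (n : WithBot ℕ∞) ≤ 3 := hn ▸ hdim
      exact_mod_cast h1
    by_cases hn2 : n ≤ 2
    · obtain ⟨A', h', hle, hfg', hreg⟩ :=
        (hCJS k).localUniformization K O A hAO hfg hfr (by rw [hn]; exact_mod_cast hn2)
      exact ⟨A', h', hle, hfg', hreg⟩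
    have hA3 : ringKrullDim A = 3 := by
      have h1 : n = 3 := by omega
      rw [hn, h1]; norm_cast
    by_cases hII : ∃ t ∈ O, ∀ p : k[X], p ≠ 0 → O.valuation (aeval t p) = 1
    · obtain ⟨t, htO, ht⟩ := hII
      obtain ⟨A', h', hle, hfg', hreg⟩ :=
        exists_fg_regular_of_residue_transcendental hCJS O A hAO hfg hfr hdim htO ht
      exact ⟨A', h', hle, hfg', hreg⟩
    push Not at hII
    have hkO : ∀ a : k, algebraMap k K a ∈ O := fun a => hAO (A.algebraMap_mem a)
    let Ok : Subalgebra k K := { O.toSubring with algebraMap_mem' := hkO }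
    have halg : ∀ x : O, ∃ p : k[X], p ≠ 0 ∧ O.valuation (aeval (x : K) p) < 1 := by
      intro x
      obtain ⟨p, hp0, hp1⟩ := hII x x.2
      have hmem : aeval (x : K) p ∈ O :=
        (Algebra.adjoin_le (Set.singleton_subset_iff.mpr x.2) : Algebra.adjoin k {(x : K)} ≤ Ok)
          (Polynomial.aeval_mem_adjoin_singleton k (x : K))
      exact ⟨p, hp0, lt_of_le_of_ne ((O.valuation_le_one_iff _).mpr hmem) hp1⟩
    haveI hcmax : (centreIdeal A O hAO).IsMaximal := by
      refine Ideal.Quotient.maximal_of_isField _ ?_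
      haveI : Algebra.IsIntegral k (A ⧸ centreIdeal A O hAO) := by
        rw [← Algebra.isAlgebraic_iff_isIntegral]
        refine ⟨fun y => ?_⟩
        obtain ⟨a, rfl⟩ := Ideal.Quotient.mk_surjective y
        obtain ⟨p, hp0, hp⟩ := halg ⟨a, hAO a.2⟩
        refine ⟨p, hp0, ?_⟩
        change aeval (Ideal.Quotient.mkₐ k (centreIdeal A O hAO) a) p = 0
        rw [Polynomial.aeval_algHom_apply]
        change Ideal.Quotient.mk (centreIdeal A O hAO) (aeval a p) = 0
        refine Ideal.Quotient.eq_zero_iff_mem.mpr ?_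
        rw [centreIdeal, Ideal.mem_comap, ValuationSubring.valuation_lt_one_iff]
        change O.valuation ((aeval a p : A) : K) < 1
        rw [Polynomial.aeval_subalgebra_coe]
        exact hp
      exact isField_of_isIntegral_of_isField' (Field.toIsField k)
    have hcdim : ringKrullDim (Localization.AtPrime (centreIdeal A O hAO)) = 3 := by
      rw [ringKrullDim_localization_atPrime_eq_of_isMaximal k (centreIdeal A O hAO), hA3]
    obtain ⟨A', h', hle, hfg', hreg⟩ :=
      exists_fg_regular_of_cpLocalUniformization_centre_rankOne O A hAO hfg hfr halg hrk
        (h3 A (centreIdeal A O hAO) hA3 hcdim)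
    exact ⟨A', h', hle, hfg', hreg⟩
  intro K _ _ O A hAO hfg hfr hdim
  haveI := hfr
  haveI : Algebra.FiniteType k A := A.fg_iff_finiteType.mp hfg
  obtain ⟨n, hn, htr⟩ := exists_ringKrullDim_eq_and_trdeg_eq k A
  have hn3 : n ≤ 3 := by
    have h1 : (n : WithBot ℕ∞) ≤ 3 := hn ▸ hdim
    exact_mod_cast h1
  have hK : Algebra.trdeg k K ≤ (3 : ℕ) := by
    rw [trdeg_eq_trdeg_of_isFractionRing A, htr]
    exact_mod_cast hn3
  obtain ⟨A', h', hle, hfg', hreg⟩ :=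
    relLocalUniformization_of_rankOne_of_trdeg_le k 3 hrank1 K hK O A hfg hfr hAO
  exact ⟨A', h', hle, hfg', hreg⟩

/-! ## The head with the formal branch and the extension chosen -/

section HeadChoice

variable {A : Type u} [CommRing A] [IsDomain A] [IsLocalRing A] [IsNoetherianRing A]
  {K : Type u} [Field K] [Algebra A K] [IsFractionRing A K]

/-- **(LU) for `A` at one valuation ring from the head's output for SOME formal branch and SOME
extension** (`∃`-form of `exists_adjoin_isRegularLocalRing_of_headAt`). Let `A` be a Noetherian
local domain essentially of finite type over a field `k` with fraction field `K` and `O` a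
valuation ring of `K`. Suppose there are: a field `K̂₁` under `Â` whose kernel is a minimal prime
with `K̂₁ = QF(Â/P̂₁)`, a ring map `ι : K → K̂₁` compatible with `A → Â`, a valuation ring `O'` of
`K̂₁` with residue field algebraic over that of `Â` (elementary form) and `O' ∩ K = O`, and a
regular local ring `S` essentially of finite type over `Â` by a local homomorphism, embedded in
`K̂₁` over `Â`, contained in and dominated by `O'`, with generators `z_j` of `𝔪_S`, exponents
`a_j ≥ 1`, units `c_j` and `g_j ∈ K` with `ι(g_j) = c_j z_j^{a_j}` — in print: "Let `v̂` be an
extension of `v` to, say `K̂₁`", `S = 𝒪_{Ŷ,ŷ}` by Thm. 1.1 for `Spec Â`, Lemma 4.7 and (511)–(512).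
Then some finitely generated `A[t] ⊆ O` is regular at the centre of `O`
(`exists_adjoin_isRegularLocalRing_of_headData`).
[cite: CossartPiltant2019, proof of Prop. 4.8 (arXiv v1: Prop. 4.6, pp. 52–53)] -/
theorem exists_adjoin_isRegularLocalRing_of_headChoiceAt (k : Type u) [Field k] [Algebra k A]
    [Algebra.EssFiniteType k A] (O : ValuationSubring K)
    (headChoice : ∃ (K₁ : Type u) (_ : Field K₁)
      (_ : Algebra (AdicCompletion (maximalIdeal A) A) K₁),
        RingHom.ker (algebraMap (AdicCompletion (maximalIdeal A) A) K₁) ∈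
          minimalPrimes (AdicCompletion (maximalIdeal A) A) ∧
        (∀ z : K₁, ∃ a b : AdicCompletion (maximalIdeal A) A,
          z = algebraMap _ K₁ a / algebraMap _ K₁ b) ∧
        ∃ (ι : K →+* K₁), ι.comp (algebraMap A K) =
          (algebraMap (AdicCompletion (maximalIdeal A) A) K₁).comp
            (algebraMap A (AdicCompletion (maximalIdeal A) A)) ∧
        ∃ (O' : ValuationSubring K₁),
          (∀ y : O', ∃ q : Polynomial (AdicCompletion (maximalIdeal A) A),
            (∃ i, q.coeff i ∉
              (maximalIdeal A).map (algebraMap A (AdicCompletion (maximalIdeal A) A))) ∧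
            O'.valuation (q.eval₂ (algebraMap (AdicCompletion (maximalIdeal A) A) K₁) y) < 1) ∧
          O'.comap ι = O ∧
          ∃ (S : Type u) (_ : CommRing S) (_ : IsRegularLocalRing S)
            (_ : Algebra (AdicCompletion (maximalIdeal A) A) S) (_ : Algebra S K₁),
            IsLocalHom (algebraMap (AdicCompletion (maximalIdeal A) A) S) ∧
            Algebra.EssFiniteType (AdicCompletion (maximalIdeal A) A) S ∧
            IsScalarTower (AdicCompletion (maximalIdeal A) A) S K₁ ∧
            Function.Injective (algebraMap S K₁) ∧
            (∀ s : S, algebraMap S K₁ s ∈ O') ∧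
            (∀ s ∈ maximalIdeal S, O'.valuation (algebraMap S K₁ s) < 1) ∧
            ∃ (d : ℕ) (z : Fin d → S) (a : Fin d → ℕ) (c : Fin d → Sˣ) (g : Fin d → K),
              Ideal.span (Set.range z) = maximalIdeal S ∧ (∀ j, 0 < a j) ∧
              ∀ j, ι (g j) = algebraMap S K₁ (c j * z j ^ a j)) :
    ∃ (t : Finset K) (h : (Algebra.adjoin A (t : Set K)).toSubring ≤ O.toSubring),
      IsRegularLocalRing (Localization.AtPrime
        (Ideal.comap (Subring.inclusion h) (maximalIdeal O))) := by
  obtain ⟨K₁, _, _, hP₁, hK₁, ι, hι, O', halgO', hO, S, _, _, _, _, hloc, hess, htower, hSK₁, hSO',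
    hdomS, d, z, a, c, g, hz, ha, hg⟩ := headChoice
  haveI := hloc
  haveI := hess
  haveI := htower
  exact exists_adjoin_isRegularLocalRing_of_headData k hP₁ hK₁ ι hι O' halgO' O hO hSK₁ hSO'
    hdomS z hz a ha c g hg

end HeadChoice

/-! ## Assemblies -/

/-- **`LocalUniformization3 k` from surface resolution and the `∃`-form geometric head ALONG
RANK-ONE VALUATIONS for the local rings `B_𝔭` over `k`** (`B` a three-dimensional domain of
finite type over `k`, `𝔭` maximal, `dim B_𝔭 = 3`; `O` a rank-one valuation ring of `Frac B_𝔭`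
containing and dominating `B_𝔭` with algebraic residue extension; the head produces, for SOME
formal branch `K̂₁`, embedding `ι` and extension `O'` with `O' ∩ K = O`, the regular local ring
`S = 𝒪_{Ŷ,ŷ}` with its monomial parameters). Proof:
`localUniformization3_of_closedPoints_rankOne_over` +
`exists_adjoin_isRegularLocalRing_of_headChoiceAt`.
[cite: CossartPiltant2019, proof of Prop. 4.8 with Lemma 4.7 (arXiv v1: Prop. 4.6, pp. 52–53)]
[cite: NovacoskiSpivakovsky2014, Thm. 1.1] -/
theorem localUniformization3_of_headChoiceRankOne (hCJS : CossartJannsenSaito2020.{0})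
    (k : Type) [Field k]
    (head : ∀ (B : Type) [CommRing B] [IsDomain B] [Algebra k B] [Algebra.FiniteType k B]
        (p : Ideal B) [p.IsMaximal], ringKrullDim B = 3 →
        ringKrullDim (Localization.AtPrime p) = 3 →
      ∀ (K : Type) [Field K] [Algebra (Localization.AtPrime p) K]
        [IsFractionRing (Localization.AtPrime p) K] (O : ValuationSubring K),
      Nonempty O.valuation.RankOne →
      (∀ x : Localization.AtPrime p, algebraMap _ K x ∈ O) →
      (∀ x ∈ maximalIdeal (Localization.AtPrime p), O.valuation (algebraMap _ K x) < 1) →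
      (∀ y : O, ∃ q : Polynomial (Localization.AtPrime p),
        (∃ i, q.coeff i ∉ maximalIdeal (Localization.AtPrime p)) ∧
        O.valuation (q.eval₂ (algebraMap _ K) y) < 1) →
      ∃ (K₁ : Type) (_ : Field K₁)
        (_ : Algebra (AdicCompletion (maximalIdeal (Localization.AtPrime p))
          (Localization.AtPrime p)) K₁),
        RingHom.ker (algebraMap (AdicCompletion (maximalIdeal (Localization.AtPrime p))
          (Localization.AtPrime p)) K₁) ∈
          minimalPrimes (AdicCompletion (maximalIdeal (Localization.AtPrime p))
            (Localization.AtPrime p)) ∧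
        (∀ z : K₁, ∃ a b : AdicCompletion (maximalIdeal (Localization.AtPrime p))
          (Localization.AtPrime p), z = algebraMap _ K₁ a / algebraMap _ K₁ b) ∧
        ∃ (ι : K →+* K₁), ι.comp (algebraMap (Localization.AtPrime p) K) =
          (algebraMap (AdicCompletion (maximalIdeal (Localization.AtPrime p))
            (Localization.AtPrime p)) K₁).comp (algebraMap (Localization.AtPrime p) _) ∧
        ∃ (O' : ValuationSubring K₁),
          (∀ y : O', ∃ q : Polynomial (AdicCompletion (maximalIdeal (Localization.AtPrime p))
            (Localization.AtPrime p)),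
            (∃ i, q.coeff i ∉ (maximalIdeal (Localization.AtPrime p)).map
              (algebraMap (Localization.AtPrime p)
                (AdicCompletion (maximalIdeal (Localization.AtPrime p))
            (Localization.AtPrime p)))) ∧
            O'.valuation (q.eval₂ (algebraMap _ K₁) y) < 1) ∧
          O'.comap ι = O ∧
          ∃ (S : Type) (_ : CommRing S) (_ : IsRegularLocalRing S)
            (_ : Algebra (AdicCompletion (maximalIdeal (Localization.AtPrime p))
              (Localization.AtPrime p)) S) (_ : Algebra S K₁),
            IsLocalHom (algebraMap (AdicCompletion (maximalIdeal (Localization.AtPrime p))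
              (Localization.AtPrime p)) S) ∧
            Algebra.EssFiniteType (AdicCompletion (maximalIdeal (Localization.AtPrime p))
              (Localization.AtPrime p)) S ∧
            IsScalarTower (AdicCompletion (maximalIdeal (Localization.AtPrime p))
              (Localization.AtPrime p)) S K₁ ∧
            Function.Injective (algebraMap S K₁) ∧
            (∀ s : S, algebraMap S K₁ s ∈ O') ∧
            (∀ s ∈ maximalIdeal S, O'.valuation (algebraMap S K₁ s) < 1) ∧
            ∃ (d : ℕ) (z : Fin d → S) (a : Fin d → ℕ) (c : Fin d → Sˣ) (g : Fin d → K),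
              Ideal.span (Set.range z) = maximalIdeal S ∧ (∀ j, 0 < a j) ∧
              ∀ j, ι (g j) = algebraMap S K₁ (c j * z j ^ a j)) :
    LocalUniformization3 k :=
  localUniformization3_of_closedPoints_rankOne_over hCJS k
    fun B _ _ _ _ p _ h1 h2 K _ _ _ O hrk hAO hdom halg => by
      haveI : IsNoetherianRing B := Algebra.FiniteType.isNoetherianRing k B
      haveI : IsNoetherianRing (Localization.AtPrime p) :=
        IsLocalization.isNoetherianRing p.primeCompl _ inferInstance
      exact exists_adjoin_isRegularLocalRing_of_headChoiceAt k O
        (head B p h1 h2 K O hrk hAO hdom halg)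

/-- **The descent leaf from surface resolution and the `∃`-form rank-one head** —
`CossartPiltant2019LU3OfComplete` (= `CossartPiltant2019LUComplete3 → CossartPiltant2019LU3`,
Cossart–Piltant 2019 journal Prop. 4.8) from `CossartJannsenSaito2020` and, for every field `k`,
the `∃`-form geometric head along rank-one valuations for the `B_𝔭` over `k`, the head being
allowed to use `CossartPiltant2019LUComplete3` (as in the source: "By assumption in this
proposition … theorem 1.1 holds for `X̂`"). Universe `0`.
[cite: CossartPiltant2019, Props. 4.6 and 4.8 with Lemma 4.7 (arXiv v1: Props. 4.4 and 4.6, pp. 50–53)]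
[cite: NovacoskiSpivakovsky2014, Thm. 1.1] -/
theorem CossartPiltant2019LU3OfComplete.of_headChoiceRankOne (hCJS : CossartJannsenSaito2020.{0})
    (head : CossartPiltant2019LUComplete3.{0} → ∀ (k : Type) [Field k],
        ∀ (B : Type) [CommRing B] [IsDomain B] [Algebra k B] [Algebra.FiniteType k B]
          (p : Ideal B) [p.IsMaximal], ringKrullDim B = 3 →
          ringKrullDim (Localization.AtPrime p) = 3 →
        ∀ (K : Type) [Field K] [Algebra (Localization.AtPrime p) K]
          [IsFractionRing (Localization.AtPrime p) K] (O : ValuationSubring K),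
        Nonempty O.valuation.RankOne →
        (∀ x : Localization.AtPrime p, algebraMap _ K x ∈ O) →
        (∀ x ∈ maximalIdeal (Localization.AtPrime p), O.valuation (algebraMap _ K x) < 1) →
        (∀ y : O, ∃ q : Polynomial (Localization.AtPrime p),
          (∃ i, q.coeff i ∉ maximalIdeal (Localization.AtPrime p)) ∧
          O.valuation (q.eval₂ (algebraMap _ K) y) < 1) →
        ∃ (K₁ : Type) (_ : Field K₁)
          (_ : Algebra (AdicCompletion (maximalIdeal (Localization.AtPrime p))
            (Localization.AtPrime p)) K₁),
          RingHom.ker (algebraMap (AdicCompletion (maximalIdeal (Localization.AtPrime p))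
            (Localization.AtPrime p)) K₁) ∈
            minimalPrimes (AdicCompletion (maximalIdeal (Localization.AtPrime p))
              (Localization.AtPrime p)) ∧
          (∀ z : K₁, ∃ a b : AdicCompletion (maximalIdeal (Localization.AtPrime p))
            (Localization.AtPrime p), z = algebraMap _ K₁ a / algebraMap _ K₁ b) ∧
          ∃ (ι : K →+* K₁), ι.comp (algebraMap (Localization.AtPrime p) K) =
            (algebraMap (AdicCompletion (maximalIdeal (Localization.AtPrime p))
              (Localization.AtPrime p)) K₁).comp (algebraMap (Localization.AtPrime p) _) ∧
          ∃ (O' : ValuationSubring K₁),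
            (∀ y : O', ∃ q : Polynomial (AdicCompletion (maximalIdeal (Localization.AtPrime p))
              (Localization.AtPrime p)),
              (∃ i, q.coeff i ∉ (maximalIdeal (Localization.AtPrime p)).map
                (algebraMap (Localization.AtPrime p)
                  (AdicCompletion (maximalIdeal (Localization.AtPrime p))
            (Localization.AtPrime p)))) ∧
              O'.valuation (q.eval₂ (algebraMap _ K₁) y) < 1) ∧
            O'.comap ι = O ∧
            ∃ (S : Type) (_ : CommRing S) (_ : IsRegularLocalRing S)
              (_ : Algebra (AdicCompletion (maximalIdeal (Localization.AtPrime p))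
                (Localization.AtPrime p)) S) (_ : Algebra S K₁),
              IsLocalHom (algebraMap (AdicCompletion (maximalIdeal (Localization.AtPrime p))
                (Localization.AtPrime p)) S) ∧
              Algebra.EssFiniteType (AdicCompletion (maximalIdeal (Localization.AtPrime p))
                (Localization.AtPrime p)) S ∧
              IsScalarTower (AdicCompletion (maximalIdeal (Localization.AtPrime p))
                (Localization.AtPrime p)) S K₁ ∧
              Function.Injective (algebraMap S K₁) ∧
              (∀ s : S, algebraMap S K₁ s ∈ O') ∧
              (∀ s ∈ maximalIdeal S, O'.valuation (algebraMap S K₁ s) < 1) ∧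
              ∃ (d : ℕ) (z : Fin d → S) (a : Fin d → ℕ) (c : Fin d → Sˣ) (g : Fin d → K),
                Ideal.span (Set.range z) = maximalIdeal S ∧ (∀ j, 0 < a j) ∧
                ∀ j, ι (g j) = algebraMap S K₁ (c j * z j ^ a j)) :
    CossartPiltant2019LU3OfComplete.{0} :=
  fun hc k _ => localUniformization3_of_headChoiceRankOne hCJS k (head hc k)

end Literature.AlgebraicGeometry.Resolution

end
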